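import Summits.QuantumAdvantage.QuantumAdvantage.Theorems.SosSandwichPseudoBoundedAAQuerySimulable
import Summits.QuantumAdvantage.QuantumAdvantage.Theorems.SosSandwichOneQueryFrameAA
import Summits.QuantumAdvantage.QuantumAdvantage.Theorems.SosSandwichMeanSquareAlg
import HarnessLib

/-!
# `AA_Q` at one query, unconditionally: every one-query quantum algorithm has a variable of influence `≥ (4/9)·Var²`

Support for route `SosSandwich` (crux `PseudoBoundedAA`, stmt-QuantumAdvantage-15237; the `Q_T` child with crux
`AA_Q`): the order-one case of `AA_Q` is a THEOREM — `Q_1 ⊆ K_1` (`exists_pseudoBounded_acceptPoly`,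
`PseudoBounded.of_eval_eq`) and the route's proved support `OneQueryFrameAA` (`4·Var² ≤ 9·maxInf` on `K_1`).
Together with `MeanSquareAlg.aaQuery_exponent_ge_two` (the exponent `2` in `Var²` cannot be lowered, witnessed by a
ONE-query algorithm) this pins the one-query corner of the `Q_T` line: `maxInf ≥ (4/9)·Var²` holds and `Var^{<2}`
fails.  [cite: AaronsonAmbainis2014, Conj. 6] [cite: BealsEtAl2001, Lemma 4.1]
-/

noncomputable section

set_option linter.dupNamespace false

namespace Summit.QuantumAdvantage.QuantumAdvantage.Theorems.SosSandwich

open Literature.Computability.Cryptography Literature.Computability.QuantumComplexity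

/-- **One quantum query needs structure (unconditional `AA_Q` at `T = 1`).**  For every one-query quantum
algorithm `Q` on `N` bits and every polynomial `p` with the cube values of `Q`'s acceptance probability and
positive variance, some variable has influence `≥ (4/9)·Var[p]²`. [cite: AaronsonAmbainis2014, Conj. 6] -/
theorem oneQuery_exists_influence_ge {N : ℕ} (Q : QQueryAlg N) (hQ : Q.queries = 1) (p : MvPolynomial (Fin N) ℝ)
    (hp : ∀ x, evalBool p x = Q.acceptProb x) (hv : 0 < boolVariance p) :
    ∃ i : Fin N, 4 * boolVariance p ^ 2 ≤ 9 * influence i p := by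
  obtain ⟨p₀, hpb, -, hval⟩ := PBAAQuerySimulable.exists_pseudoBounded_acceptPoly Q
  have hpK : PseudoBounded 1 p := by
    rw [← hQ]
    exact hpb.of_eval_eq fun x => by
      change evalBool p x = evalBool p₀ x
      rw [hp x, hval x]
  exact OneQueryFrameAA_proof N p hpK hv

/-- The one-query corner of `AA_Q`, both sides: the law `maxInf ≥ (4/9)·Var²` HOLDS for every one-query algorithm,
and no law `maxInf ≥ C·Var^c` with `c < 2` holds even for one-query algorithms
(`MeanSquareAlg.aaQuery_exponent_ge_two`). [cite: AaronsonAmbainis2014, Conj. 6] -/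
theorem oneQuery_corner :
    (∀ (N : ℕ) (Q : QQueryAlg N) (p : MvPolynomial (Fin N) ℝ), Q.queries = 1 →
        (∀ x, evalBool p x = Q.acceptProb x) → 0 < boolVariance p →
          ∃ i : Fin N, 4 * boolVariance p ^ 2 ≤ 9 * influence i p) ∧
      (∀ (c : ℕ) (C : ℝ), 0 < C →
        (∀ (N : ℕ) (Q : QQueryAlg N) (p : MvPolynomial (Fin N) ℝ) (ε : ℝ),
          1 ≤ Q.queries → (∀ x, evalBool p x = Q.acceptProb x) → 0 < ε → ε ≤ boolVariance p →
            ∃ i : Fin N, C * (ε / Q.queries) ^ c ≤ influence i p) → 2 ≤ c) :=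
  ⟨fun _ Q p hQ hp hv => oneQuery_exists_influence_ge Q hQ p hp hv,
    fun c _ hC h => MeanSquareAlg.aaQuery_exponent_ge_two c hC h⟩

end Summit.QuantumAdvantage.QuantumAdvantage.Theorems.SosSandwich

end
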